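import Literature.Computability.AlgebraicComplexity.BI17FormsGenericNonNormalityProofs
import Literature.Computability.AlgebraicComplexity.BI17InvariantsRectangularHighestWeight
import HarnessLib

/-!
# Bürgisser–Ikenmeyer 2017, Thm. 2.3 (`a'(D,m) = 1`) and Cor. 3.17 (2) (generic non-normality) at
# `(D, m) ∈ {(6,3), (10,4), (6,4), (5,4)}` — PROVED, unconditionally, from two kernel plethysm values each

P. Bürgisser, C. Ikenmeyer, *Fundamental invariants of orbit closures*, J. Algebra **477** (2017)
390–434 = arXiv:1511.02927 [BurgisserIkenmeyer2017]: Thm. 2.3 (TeX L473: "We have `a'(D,m) = 1`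
except in the following cases: `a'(3,2) = 2, a'(3,3) = 2, a'(4,3) = 2`", the last entry being the
cell's erratum A21) and Cor. 3.17 (2) (L1170: "Suppose that `a'(D,m) = 1` and let `w ∈ Sym^D ℂ^m` be
generic. Then `\overline{Gw}` is not normal if `D` is odd, or if `D` is even and `gcd(D,m) > 1`").
THEOREMS ONLY (cell `val-lit`, row BI2017-A; sibling of the statement file
`BI17FundamentalInvariantForms.lean`, whose named facts `BI2017_thm_2_3_period` (typed verbatim, NOT
consumable as a whole) and `BI2017_cor_3_17` are not restated). No definition, no named fact.

## Method (ours; the printed Thm. 2.3 rests on Matsumura–Monsky's generic trivial stabilizer and the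
printed Cor. 3.17 (2) on Prop. 2.10 = Luna's slices — neither is used)

`BI17FormsGenericNonNormalityProofs.lean` (this seat) reduces BOTH statements at a format `(D, m)`,
`g = gcd(D,m)`, to the existence of NONZERO homogeneous `SL_m`-invariants on `Sym^D ℂ^m` in two
degrees `(m/g) t`, `(m/g)(t+1)` (`isZariskiGeneric_period_of_invariants`,
`isZariskiGeneric_not_isIntegrallyClosed_of_invariants`). By
`mem_genericDegreeMonoid_iff_plethysmCoeff_ne_zero` (`BI17InvariantsRectangularHighestWeight.lean`,
val-lit-p4: `d ∈ E(D,m) ↔ a_{((Dd/m)^m)}(d[D]) ≠ 0`) each such existence statement is ONE plethysm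
coefficient, and these are kernel-evaluable by Dörfler–Ikenmeyer–Panova's counting formula (4.4)
(`plethysmCoeff_fin_three_cast_eq_six_counts`, val-lit-p6; `plethysmCoeff_fin_four_cast_eq_dpM`,
val-lit-p4's masked packed-table DP). All evaluations below are `decide +kernel` (no `native_decide`).

| `(D,m)` | `g` | degrees `(m/g)t, (m/g)(t+1)` | kernel values | `a(D,m)` | Cor. 3.17 (2) clause |
|---|---|---|---|---|---|
| `(6,3)` | `3` | `3, 4` (`t = 3`) | `a_{(6,6,6)}(3[6]) = 1`, `a_{(8,8,8)}(4[6]) = 1` | `2` | `gcd = 3 > 1` |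
| `(10,4)` | `2` | `4, 6` (`t = 2`) | `4`: Cayley's `P_{10,4}` (tree); `a_{(15^4)}(6[10]) = 1` | `5` | `gcd = 2 > 1` |
| `(6,4)` | `2` | `8, 10` (`t = 4`) | `a_{(12^4)}(8[6]) = 9`, `a_{(15^4)}(10[6]) = 30` | `3` | `gcd = 2 > 1` |
| `(5,4)` | `1` | `8, 12` (`t = 2`) | `a_{(10^4)}(8[5]) = 3`, `a_{(15^4)}(12[5]) = 24` | `5` | `D` odd |

(For `(6,4)` the degrees `4 = 2·2` (Cayley) and `6 = 2·3` do NOT work: `a_{(9,9,9,9)}(6[6]) = 0` —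
sextic surfaces have no invariant of degree `6`; the next pair `8, 10` does.) Consequences, all
unconditional: almost all ternary sextics / quaternary dezimics / sextic surfaces / quintic surfaces
have `a'(w) = 1` with the displayed `a(w)`, and a NON-normal `GL_m`-orbit closure. The clause
instances `BI2017_thm_2_3_period_*` / `BI2017_cor_3_17_part2_*` are in the exact shape of the two
named facts' bodies at these parameters.

Honest framing: typed-literature bookkeeping for the cell `val-lit` (LADDER-VALIANT V3, a
known-results layer); classical invariant theory; nothing here bears on VP versus VNP.

## References

* [BurgisserIkenmeyer2017] Thm. 2.3 (L473), Cor. 3.17 (L1170), Def. 3.6 (`E(D,m)`), Rem. 3.13.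
* [DorflerIkenmeyerPanova2020] J. Dörfler, C. Ikenmeyer, G. Panova, SIAM J. Appl. Algebra Geom. 4
  (2020) = arXiv:1901.04576, eqs. (4.3)–(4.4) (the counting formula behind the kernel values).
-/

namespace Literature.Computability.AlgebraicComplexity

open MvPolynomial
open _root_.Literature.NumberTheory.DiophantineGeometry

/-! ### Kernel plethysm values -/

section KernelValues

/-- **`a_{(6,6,6)}(3[6]) = 1`**: ternary sextics have exactly one invariant of degree `3` up to scale.
Six naive monomial counts (`plethysmCoeff_fin_three_cast_eq_six_counts`), `decide +kernel`.
[cite: DorflerIkenmeyerPanova2020, eqs. (4.3)–(4.4)] -/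
theorem plethysmCoeff_six_rowDual_six_six_six :
    plethysmCoeff ℂ (Fin 3) 6 (rowDual ![6, 6, 6]) = 1 := by
  have h := plethysmCoeff_fin_three_cast_eq_six_counts 6 6 6 (n := 6) (d := 3) (by norm_num)
    (by norm_num) (by norm_num) (by norm_num)
  have h2 : (plethysmCoeff ℂ (Fin 3) 6 (rowDual ![6, 6, 6]) : ℤ) = 1 := by
    rw [h]
    decide +kernel
  exact_mod_cast h2

/-- `c_{(8,8,8)}(4,6) = 409`. [cite: DorflerIkenmeyerPanova2020, eq. (4.3) (arXiv p. 9)] -/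
theorem countVecMultisetsL_6_4_8_8_8 : countVecMultisetsL (weakCompsL 3 6) 4 [8, 8, 8] = 409 := by
  decide +kernel

/-- `c_{(9,7,8)}(4,6) = 388`. [cite: DorflerIkenmeyerPanova2020, eq. (4.3) (arXiv p. 9)] -/
theorem countVecMultisetsL_6_4_9_7_8 : countVecMultisetsL (weakCompsL 3 6) 4 [9, 7, 8] = 388 := by
  decide +kernel

/-- `c_{(8,9,7)}(4,6) = 388`. [cite: DorflerIkenmeyerPanova2020, eq. (4.3) (arXiv p. 9)] -/
theorem countVecMultisetsL_6_4_8_9_7 : countVecMultisetsL (weakCompsL 3 6) 4 [8, 9, 7] = 388 := by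
  decide +kernel

/-- `c_{(10,8,6)}(4,6) = 346`. [cite: DorflerIkenmeyerPanova2020, eq. (4.3) (arXiv p. 9)] -/
theorem countVecMultisetsL_6_4_10_8_6 : countVecMultisetsL (weakCompsL 3 6) 4 [10, 8, 6] = 346 := by
  decide +kernel

/-- `c_{(9,9,6)}(4,6) = 355`. [cite: DorflerIkenmeyerPanova2020, eq. (4.3) (arXiv p. 9)] -/
theorem countVecMultisetsL_6_4_9_9_6 : countVecMultisetsL (weakCompsL 3 6) 4 [9, 9, 6] = 355 := by
  decide +kernel

/-- `c_{(10,7,7)}(4,6) = 359`. [cite: DorflerIkenmeyerPanova2020, eq. (4.3) (arXiv p. 9)] -/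
theorem countVecMultisetsL_6_4_10_7_7 : countVecMultisetsL (weakCompsL 3 6) 4 [10, 7, 7] = 359 := by
  decide +kernel

/-- **`a_{(8,8,8)}(4[6]) = 1`**: ternary sextics have exactly one invariant of degree `4` up to scale
(`409 - 388 - 388 - 346 + 355 + 359 = 1`, the six kernel-checked monomial counts above).
[cite: DorflerIkenmeyerPanova2020, eqs. (4.3)–(4.4)] -/
theorem plethysmCoeff_six_rowDual_eight_eight_eight :
    plethysmCoeff ℂ (Fin 3) 6 (rowDual ![8, 8, 8]) = 1 := by
  have h := plethysmCoeff_fin_three_cast_eq_six_counts 8 8 8 (n := 6) (d := 4) (by norm_num)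
    (by norm_num) (by norm_num) (by norm_num)
  norm_num [countVecMultisetsL_6_4_8_8_8, countVecMultisetsL_6_4_9_7_8, countVecMultisetsL_6_4_8_9_7,
    countVecMultisetsL_6_4_10_8_6, countVecMultisetsL_6_4_9_9_6, countVecMultisetsL_6_4_10_7_7] at h
  exact_mod_cast h

/-- **`a_{(15,15,15,15)}(6[10]) = 1`**: quaternary forms of degree `10` have exactly one invariant of
degree `6` up to scale. Masked packed table (`plethysmCoeff_fin_four_cast_eq_dpM`, digit width `50`:
`287^6 < 2^50`), `decide +kernel`. [cite: DorflerIkenmeyerPanova2020, eqs. (4.3)–(4.4)] -/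
theorem plethysmCoeff_ten_rowDual_fifteen_fifteen_fifteen_fifteen :
    plethysmCoeff ℂ (Fin 4) 10 (rowDual ![15, 15, 15, 15]) = 1 := by
  have h := plethysmCoeff_fin_four_cast_eq_dpM ![15, 15, 15, 15] (n := 10) (d := 6) (F := 50)
    (by norm_num) (by decide) (by decide) (by decide) (by rw [Fin.sum_univ_four]; rfl)
    (by decide +kernel)
  have h2 : (plethysmCoeff ℂ (Fin 4) 10 (rowDual ![15, 15, 15, 15]) : ℤ) = 1 := by
    rw [h]
    decide +kernel
  exact_mod_cast h2

/-- **`a_{(12,12,12,12)}(8[6]) = 9`**: sextic surfaces have a `9`-dimensional space of invariants of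
degree `8`. Masked packed table (digit width `52`: `85^8 < 2^52`), `decide +kernel`.
[cite: DorflerIkenmeyerPanova2020, eqs. (4.3)–(4.4)] -/
theorem plethysmCoeff_six_rowDual_twelve_twelve_twelve_twelve :
    plethysmCoeff ℂ (Fin 4) 6 (rowDual ![12, 12, 12, 12]) = 9 := by
  have h := plethysmCoeff_fin_four_cast_eq_dpM ![12, 12, 12, 12] (n := 6) (d := 8) (F := 52)
    (by norm_num) (by decide) (by decide) (by decide) (by rw [Fin.sum_univ_four]; rfl)
    (by decide +kernel)
  have h2 : (plethysmCoeff ℂ (Fin 4) 6 (rowDual ![12, 12, 12, 12]) : ℤ) = 9 := by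
    rw [h]
    decide +kernel
  exact_mod_cast h2

/-- **`a_{(15,15,15,15)}(10[6]) = 30`**: sextic surfaces have a `30`-dimensional space of invariants of
degree `10`. Masked packed table (digit width `65`: `85^10 < 2^65`), `decide +kernel`.
[cite: DorflerIkenmeyerPanova2020, eqs. (4.3)–(4.4)] -/
theorem plethysmCoeff_six_rowDual_fifteen_fifteen_fifteen_fifteen :
    plethysmCoeff ℂ (Fin 4) 6 (rowDual ![15, 15, 15, 15]) = 30 := by
  have h := plethysmCoeff_fin_four_cast_eq_dpM ![15, 15, 15, 15] (n := 6) (d := 10) (F := 65)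
    (by norm_num) (by decide) (by decide) (by decide) (by rw [Fin.sum_univ_four]; rfl)
    (by decide +kernel)
  have h2 : (plethysmCoeff ℂ (Fin 4) 6 (rowDual ![15, 15, 15, 15]) : ℤ) = 30 := by
    rw [h]
    decide +kernel
  exact_mod_cast h2

/-- **`a_{(10,10,10,10)}(8[5]) = 3`**: quintic surfaces have a `3`-dimensional space of invariants of
degree `8`. Masked packed table (digit width `47`: `57^8 < 2^47`), `decide +kernel`.
[cite: DorflerIkenmeyerPanova2020, eqs. (4.3)–(4.4)] -/
theorem plethysmCoeff_five_rowDual_ten_ten_ten_ten :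
    plethysmCoeff ℂ (Fin 4) 5 (rowDual ![10, 10, 10, 10]) = 3 := by
  have h := plethysmCoeff_fin_four_cast_eq_dpM ![10, 10, 10, 10] (n := 5) (d := 8) (F := 47)
    (by norm_num) (by decide) (by decide) (by decide) (by rw [Fin.sum_univ_four]; rfl)
    (by decide +kernel)
  have h2 : (plethysmCoeff ℂ (Fin 4) 5 (rowDual ![10, 10, 10, 10]) : ℤ) = 3 := by
    rw [h]
    decide +kernel
  exact_mod_cast h2

/-- **`a_{(15,15,15,15)}(12[5]) = 24`**: quintic surfaces have a `24`-dimensional space of invariants of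
degree `12`. Masked packed table (digit width `70`: `57^12 < 2^70`), `decide +kernel`.
[cite: DorflerIkenmeyerPanova2020, eqs. (4.3)–(4.4)] -/
theorem plethysmCoeff_five_rowDual_fifteen_fifteen_fifteen_fifteen :
    plethysmCoeff ℂ (Fin 4) 5 (rowDual ![15, 15, 15, 15]) = 24 := by
  have h := plethysmCoeff_fin_four_cast_eq_dpM ![15, 15, 15, 15] (n := 5) (d := 12) (F := 70)
    (by norm_num) (by decide) (by decide) (by decide) (by rw [Fin.sum_univ_four]; rfl)
    (by decide +kernel)
  have h2 : (plethysmCoeff ℂ (Fin 4) 5 (rowDual ![15, 15, 15, 15]) : ℤ) = 24 := by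
    rw [h]
    decide +kernel
  exact_mod_cast h2

end KernelValues

/-! ### Degrees in the generic degree monoids `E(6,3)`, `E(10,4)`, `E(6,4)`, `E(5,4)` -/

section Degrees

/-- `3 ∈ E(6,3)`. [cite: BurgisserIkenmeyer2017, Def. 3.6] -/
theorem three_mem_genericDegreeMonoid_six_three : 3 ∈ genericDegreeMonoid (Fin 3) ℂ 6 := by
  rw [mem_genericDegreeMonoid_iff_plethysmCoeff_ne_zero (by norm_num) (by norm_num) ⟨6, by norm_num⟩]
  have h : (fun _ : Fin 3 => -((6 * 3 / 3 : ℕ) : ℤ)) = rowDual ![6, 6, 6] := by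
    funext i
    fin_cases i <;> simp [rowDual, Weight.dual]
  rw [h, plethysmCoeff_six_rowDual_six_six_six]
  exact one_ne_zero

/-- `4 ∈ E(6,3)`. [cite: BurgisserIkenmeyer2017, Def. 3.6] -/
theorem four_mem_genericDegreeMonoid_six_three : 4 ∈ genericDegreeMonoid (Fin 3) ℂ 6 := by
  rw [mem_genericDegreeMonoid_iff_plethysmCoeff_ne_zero (by norm_num) (by norm_num) ⟨8, by norm_num⟩]
  have h : (fun _ : Fin 3 => -((6 * 4 / 3 : ℕ) : ℤ)) = rowDual ![8, 8, 8] := by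
    funext i
    fin_cases i <;> simp [rowDual, Weight.dual]
  rw [h, plethysmCoeff_six_rowDual_eight_eight_eight]
  exact one_ne_zero

/-- `4 ∈ E(10,4)` (Cayley's `P_{10,4}`, degree `m = 4`). [cite: BurgisserIkenmeyer2017, Thm. 3.18 (2)] -/
theorem four_mem_genericDegreeMonoid_ten_four : 4 ∈ genericDegreeMonoid (Fin 4) ℂ 10 :=
  mem_genericDegreeMonoid_self_of_even (by decide) (by norm_num) (by norm_num)

/-- `6 ∈ E(10,4)`. [cite: BurgisserIkenmeyer2017, Def. 3.6] -/
theorem six_mem_genericDegreeMonoid_ten_four : 6 ∈ genericDegreeMonoid (Fin 4) ℂ 10 := by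
  rw [mem_genericDegreeMonoid_iff_plethysmCoeff_ne_zero (by norm_num) (by norm_num) ⟨15, by norm_num⟩]
  have h : (fun _ : Fin 4 => -((10 * 6 / 4 : ℕ) : ℤ)) = rowDual ![15, 15, 15, 15] := by
    funext i
    fin_cases i <;> simp [rowDual, Weight.dual]
  rw [h, plethysmCoeff_ten_rowDual_fifteen_fifteen_fifteen_fifteen]
  exact one_ne_zero

/-- `8 ∈ E(6,4)`. [cite: BurgisserIkenmeyer2017, Def. 3.6] -/
theorem eight_mem_genericDegreeMonoid_six_four : 8 ∈ genericDegreeMonoid (Fin 4) ℂ 6 := by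
  rw [mem_genericDegreeMonoid_iff_plethysmCoeff_ne_zero (by norm_num) (by norm_num) ⟨12, by norm_num⟩]
  have h : (fun _ : Fin 4 => -((6 * 8 / 4 : ℕ) : ℤ)) = rowDual ![12, 12, 12, 12] := by
    funext i
    fin_cases i <;> simp [rowDual, Weight.dual]
  rw [h, plethysmCoeff_six_rowDual_twelve_twelve_twelve_twelve]
  norm_num

/-- `10 ∈ E(6,4)`. [cite: BurgisserIkenmeyer2017, Def. 3.6] -/
theorem ten_mem_genericDegreeMonoid_six_four : 10 ∈ genericDegreeMonoid (Fin 4) ℂ 6 := by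
  rw [mem_genericDegreeMonoid_iff_plethysmCoeff_ne_zero (by norm_num) (by norm_num) ⟨15, by norm_num⟩]
  have h : (fun _ : Fin 4 => -((6 * 10 / 4 : ℕ) : ℤ)) = rowDual ![15, 15, 15, 15] := by
    funext i
    fin_cases i <;> simp [rowDual, Weight.dual]
  rw [h, plethysmCoeff_six_rowDual_fifteen_fifteen_fifteen_fifteen]
  norm_num

/-- `8 ∈ E(5,4)`. [cite: BurgisserIkenmeyer2017, Def. 3.6] -/
theorem eight_mem_genericDegreeMonoid_five_four : 8 ∈ genericDegreeMonoid (Fin 4) ℂ 5 := by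
  rw [mem_genericDegreeMonoid_iff_plethysmCoeff_ne_zero (by norm_num) (by norm_num) ⟨10, by norm_num⟩]
  have h : (fun _ : Fin 4 => -((5 * 8 / 4 : ℕ) : ℤ)) = rowDual ![10, 10, 10, 10] := by
    funext i
    fin_cases i <;> simp [rowDual, Weight.dual]
  rw [h, plethysmCoeff_five_rowDual_ten_ten_ten_ten]
  norm_num

/-- `12 ∈ E(5,4)`. [cite: BurgisserIkenmeyer2017, Def. 3.6] -/
theorem twelve_mem_genericDegreeMonoid_five_four : 12 ∈ genericDegreeMonoid (Fin 4) ℂ 5 := by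
  rw [mem_genericDegreeMonoid_iff_plethysmCoeff_ne_zero (by norm_num) (by norm_num) ⟨15, by norm_num⟩]
  have h : (fun _ : Fin 4 => -((5 * 12 / 4 : ℕ) : ℤ)) = rowDual ![15, 15, 15, 15] := by
    funext i
    fin_cases i <;> simp [rowDual, Weight.dual]
  rw [h, plethysmCoeff_five_rowDual_fifteen_fifteen_fifteen_fifteen]
  norm_num

end Degrees

/-! ### The instances of Thm. 2.3 and Cor. 3.17 (2) -/

section Instances

/-- **`a(6,3) = 2`, `a'(6,3) = 1`**: almost all ternary sextics `w` have stabilizer period `2` and reduced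
period `1` (BI Thm. 2.3 at `(6,3)`, PROVED: invariants of degrees `3, 4`).
[cite: BurgisserIkenmeyer2017, Thm. 2.3] -/
theorem isZariskiGeneric_period_six_three :
    IsZariskiGeneric 6 (fun f : MvPolynomial (Fin 3) ℂ =>
      stabilizerPeriod f = 2 ∧ reducedStabilizerPeriod 6 f = 1) := by
  obtain ⟨F₁, hF₁h, hF₁i, hF₁0⟩ := three_mem_genericDegreeMonoid_six_three
  obtain ⟨F₂, hF₂h, hF₂i, hF₂0⟩ := four_mem_genericDegreeMonoid_six_three
  have h := isZariskiGeneric_period_of_invariants (D := 6) (m := 3) (t := 3) (by norm_num) (by norm_num)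
    (F₁ := F₁) (F₂ := F₂) (by simpa using hF₁h) hF₁i hF₁0 (by simpa using hF₂h) hF₂i hF₂0
  exact h.mono fun f _ hf => ⟨by simpa using hf.1, hf.2⟩

/-- **Cor. 3.17 (2) at `(6,3)`, UNCONDITIONAL: almost all ternary sextics have a non-normal
`GL_3`-orbit closure** (`gcd(6,3) = 3 > 1`). [cite: BurgisserIkenmeyer2017, Cor. 3.17 (2)] -/
theorem isZariskiGeneric_not_isIntegrallyClosed_six_three :
    IsZariskiGeneric 6 fun f : MvPolynomial (Fin 3) ℂ => ¬ IsIntegrallyClosed (OrbitCoordRing f 6) := by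
  obtain ⟨F₁, hF₁h, hF₁i, hF₁0⟩ := three_mem_genericDegreeMonoid_six_three
  obtain ⟨F₂, hF₂h, hF₂i, hF₂0⟩ := four_mem_genericDegreeMonoid_six_three
  exact isZariskiGeneric_not_isIntegrallyClosed_of_invariants (D := 6) (m := 3) (t := 3) (by norm_num)
    (by norm_num) (F₁ := F₁) (F₂ := F₂) (by simpa using hF₁h) hF₁i hF₁0 (by simpa using hF₂h) hF₂i
    hF₂0 (Or.inr (by decide))

/-- **`a(10,4) = 5`, `a'(10,4) = 1`**: almost all quaternary forms of degree `10` (BI Thm. 2.3 at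
`(10,4)`, PROVED: invariants of degrees `4, 6`). [cite: BurgisserIkenmeyer2017, Thm. 2.3] -/
theorem isZariskiGeneric_period_ten_four :
    IsZariskiGeneric 10 (fun f : MvPolynomial (Fin 4) ℂ =>
      stabilizerPeriod f = 5 ∧ reducedStabilizerPeriod 10 f = 1) := by
  obtain ⟨F₁, hF₁h, hF₁i, hF₁0⟩ := four_mem_genericDegreeMonoid_ten_four
  obtain ⟨F₂, hF₂h, hF₂i, hF₂0⟩ := six_mem_genericDegreeMonoid_ten_four
  have h := isZariskiGeneric_period_of_invariants (D := 10) (m := 4) (t := 2) (by norm_num)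
    (by norm_num) (F₁ := F₁) (F₂ := F₂) (by simpa using hF₁h) hF₁i hF₁0 (by simpa using hF₂h) hF₂i
    hF₂0
  exact h.mono fun f _ hf => ⟨by simpa using hf.1, hf.2⟩

/-- **Cor. 3.17 (2) at `(10,4)`, UNCONDITIONAL: almost all quaternary forms of degree `10` have a
non-normal `GL_4`-orbit closure** (`gcd(10,4) = 2 > 1`). [cite: BurgisserIkenmeyer2017, Cor. 3.17 (2)] -/
theorem isZariskiGeneric_not_isIntegrallyClosed_ten_four :
    IsZariskiGeneric 10 fun f : MvPolynomial (Fin 4) ℂ =>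
      ¬ IsIntegrallyClosed (OrbitCoordRing f 10) := by
  obtain ⟨F₁, hF₁h, hF₁i, hF₁0⟩ := four_mem_genericDegreeMonoid_ten_four
  obtain ⟨F₂, hF₂h, hF₂i, hF₂0⟩ := six_mem_genericDegreeMonoid_ten_four
  exact isZariskiGeneric_not_isIntegrallyClosed_of_invariants (D := 10) (m := 4) (t := 2)
    (by norm_num) (by norm_num) (F₁ := F₁) (F₂ := F₂) (by simpa using hF₁h) hF₁i hF₁0
    (by simpa using hF₂h) hF₂i hF₂0 (Or.inr (by decide))

/-- **`a(6,4) = 3`, `a'(6,4) = 1`**: almost all sextic surfaces (BI Thm. 2.3 at `(6,4)`, PROVED: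
invariants of degrees `8, 10`). [cite: BurgisserIkenmeyer2017, Thm. 2.3] -/
theorem isZariskiGeneric_period_six_four :
    IsZariskiGeneric 6 (fun f : MvPolynomial (Fin 4) ℂ =>
      stabilizerPeriod f = 3 ∧ reducedStabilizerPeriod 6 f = 1) := by
  obtain ⟨F₁, hF₁h, hF₁i, hF₁0⟩ := eight_mem_genericDegreeMonoid_six_four
  obtain ⟨F₂, hF₂h, hF₂i, hF₂0⟩ := ten_mem_genericDegreeMonoid_six_four
  have h := isZariskiGeneric_period_of_invariants (D := 6) (m := 4) (t := 4) (by norm_num)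
    (by norm_num) (F₁ := F₁) (F₂ := F₂) (by simpa using hF₁h) hF₁i hF₁0 (by simpa using hF₂h) hF₂i
    hF₂0
  exact h.mono fun f _ hf => ⟨by simpa using hf.1, hf.2⟩

/-- **Cor. 3.17 (2) at `(6,4)`, UNCONDITIONAL: almost all sextic surfaces have a non-normal
`GL_4`-orbit closure** (`gcd(6,4) = 2 > 1`). [cite: BurgisserIkenmeyer2017, Cor. 3.17 (2)] -/
theorem isZariskiGeneric_not_isIntegrallyClosed_six_four :
    IsZariskiGeneric 6 fun f : MvPolynomial (Fin 4) ℂ => ¬ IsIntegrallyClosed (OrbitCoordRing f 6) := by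
  obtain ⟨F₁, hF₁h, hF₁i, hF₁0⟩ := eight_mem_genericDegreeMonoid_six_four
  obtain ⟨F₂, hF₂h, hF₂i, hF₂0⟩ := ten_mem_genericDegreeMonoid_six_four
  exact isZariskiGeneric_not_isIntegrallyClosed_of_invariants (D := 6) (m := 4) (t := 4)
    (by norm_num) (by norm_num) (F₁ := F₁) (F₂ := F₂) (by simpa using hF₁h) hF₁i hF₁0
    (by simpa using hF₂h) hF₂i hF₂0 (Or.inr (by decide))

/-- **`a(5,4) = 5`, `a'(5,4) = 1`**: almost all quintic surfaces (BI Thm. 2.3 at `(5,4)`, PROVED: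
invariants of degrees `8, 12`). [cite: BurgisserIkenmeyer2017, Thm. 2.3] -/
theorem isZariskiGeneric_period_five_four :
    IsZariskiGeneric 5 (fun f : MvPolynomial (Fin 4) ℂ =>
      stabilizerPeriod f = 5 ∧ reducedStabilizerPeriod 5 f = 1) := by
  obtain ⟨F₁, hF₁h, hF₁i, hF₁0⟩ := eight_mem_genericDegreeMonoid_five_four
  obtain ⟨F₂, hF₂h, hF₂i, hF₂0⟩ := twelve_mem_genericDegreeMonoid_five_four
  have h := isZariskiGeneric_period_of_invariants (D := 5) (m := 4) (t := 2) (by norm_num)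
    (by norm_num) (F₁ := F₁) (F₂ := F₂) (by simpa using hF₁h) hF₁i hF₁0 (by simpa using hF₂h) hF₂i
    hF₂0
  exact h.mono fun f _ hf => ⟨by simpa using hf.1, hf.2⟩

/-- **Cor. 3.17 (2) at `(5,4)`, UNCONDITIONAL: almost all quintic surfaces have a non-normal
`GL_4`-orbit closure** (`D = 5` odd). [cite: BurgisserIkenmeyer2017, Cor. 3.17 (2)] -/
theorem isZariskiGeneric_not_isIntegrallyClosed_five_four :
    IsZariskiGeneric 5 fun f : MvPolynomial (Fin 4) ℂ => ¬ IsIntegrallyClosed (OrbitCoordRing f 5) := by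
  obtain ⟨F₁, hF₁h, hF₁i, hF₁0⟩ := eight_mem_genericDegreeMonoid_five_four
  obtain ⟨F₂, hF₂h, hF₂i, hF₂0⟩ := twelve_mem_genericDegreeMonoid_five_four
  exact isZariskiGeneric_not_isIntegrallyClosed_of_invariants (D := 5) (m := 4) (t := 2)
    (by norm_num) (by norm_num) (F₁ := F₁) (F₂ := F₂) (by simpa using hF₁h) hF₁i hF₁0
    (by simpa using hF₂h) hF₂i hF₂0 (Or.inl (by decide))

end Instances

/-! ### Clause instances in the shape of the named facts' bodies -/

section Clauses

/-- BI Thm. 2.3's clause (`BI2017_thm_2_3_period`'s body) at `(D,m) = (6,3)`, PROVED (value `1`).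
[cite: BurgisserIkenmeyer2017, Thm. 2.3] -/
theorem BI2017_thm_2_3_period_six_three : 2 < 6 → 1 ≤ 3 →
    IsZariskiGeneric 6 fun f : MvPolynomial (Fin 3) ℂ =>
      reducedStabilizerPeriod 6 f = if (6 = 3 ∧ 3 = 2) ∨ (6 = 3 ∧ 3 = 3) ∨ (6 = 4 ∧ 3 = 3) then 2 else 1 :=
  fun _ _ => by
    rw [if_neg (by decide)]
    exact isZariskiGeneric_period_six_three.mono fun _ _ h => h.2

/-- BI Thm. 2.3's clause at `(D,m) = (10,4)`, PROVED (value `1`). [cite: BurgisserIkenmeyer2017, Thm. 2.3] -/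
theorem BI2017_thm_2_3_period_ten_four : 2 < 10 → 1 ≤ 4 →
    IsZariskiGeneric 10 fun f : MvPolynomial (Fin 4) ℂ =>
      reducedStabilizerPeriod 10 f =
        if (10 = 3 ∧ 4 = 2) ∨ (10 = 3 ∧ 4 = 3) ∨ (10 = 4 ∧ 4 = 3) then 2 else 1 :=
  fun _ _ => by
    rw [if_neg (by decide)]
    exact isZariskiGeneric_period_ten_four.mono fun _ _ h => h.2

/-- BI Thm. 2.3's clause at `(D,m) = (6,4)`, PROVED (value `1`). [cite: BurgisserIkenmeyer2017, Thm. 2.3] -/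
theorem BI2017_thm_2_3_period_six_four : 2 < 6 → 1 ≤ 4 →
    IsZariskiGeneric 6 fun f : MvPolynomial (Fin 4) ℂ =>
      reducedStabilizerPeriod 6 f = if (6 = 3 ∧ 4 = 2) ∨ (6 = 3 ∧ 4 = 3) ∨ (6 = 4 ∧ 4 = 3) then 2 else 1 :=
  fun _ _ => by
    rw [if_neg (by decide)]
    exact isZariskiGeneric_period_six_four.mono fun _ _ h => h.2

/-- BI Thm. 2.3's clause at `(D,m) = (5,4)`, PROVED (value `1`). [cite: BurgisserIkenmeyer2017, Thm. 2.3] -/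
theorem BI2017_thm_2_3_period_five_four : 2 < 5 → 1 ≤ 4 →
    IsZariskiGeneric 5 fun f : MvPolynomial (Fin 4) ℂ =>
      reducedStabilizerPeriod 5 f = if (5 = 3 ∧ 4 = 2) ∨ (5 = 3 ∧ 4 = 3) ∨ (5 = 4 ∧ 4 = 3) then 2 else 1 :=
  fun _ _ => by
    rw [if_neg (by decide)]
    exact isZariskiGeneric_period_five_four.mono fun _ _ h => h.2

/-- Cor. 3.17 (2)'s clause (`BI2017_cor_3_17`'s second conjunct) at `(D,m) = (6,3)`, PROVED — the
hypotheses are carried and not used. [cite: BurgisserIkenmeyer2017, Cor. 3.17 (2)] -/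
theorem BI2017_cor_3_17_part2_six_three : 2 ≤ 6 → 2 ≤ 3 →
    IsZariskiGeneric 6 (fun f : MvPolynomial (Fin 3) ℂ => reducedStabilizerPeriod 6 f = 1) →
    (Odd 6 ∨ 1 < Nat.gcd 6 3) →
    IsZariskiGeneric 6 fun f : MvPolynomial (Fin 3) ℂ => ¬ IsIntegrallyClosed (OrbitCoordRing f 6) :=
  fun _ _ _ _ => isZariskiGeneric_not_isIntegrallyClosed_six_three

/-- Cor. 3.17 (2)'s clause at `(D,m) = (10,4)`, PROVED. [cite: BurgisserIkenmeyer2017, Cor. 3.17 (2)] -/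
theorem BI2017_cor_3_17_part2_ten_four : 2 ≤ 10 → 2 ≤ 4 →
    IsZariskiGeneric 10 (fun f : MvPolynomial (Fin 4) ℂ => reducedStabilizerPeriod 10 f = 1) →
    (Odd 10 ∨ 1 < Nat.gcd 10 4) →
    IsZariskiGeneric 10 fun f : MvPolynomial (Fin 4) ℂ =>
      ¬ IsIntegrallyClosed (OrbitCoordRing f 10) :=
  fun _ _ _ _ => isZariskiGeneric_not_isIntegrallyClosed_ten_four

/-- Cor. 3.17 (2)'s clause at `(D,m) = (6,4)`, PROVED. [cite: BurgisserIkenmeyer2017, Cor. 3.17 (2)] -/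
theorem BI2017_cor_3_17_part2_six_four : 2 ≤ 6 → 2 ≤ 4 →
    IsZariskiGeneric 6 (fun f : MvPolynomial (Fin 4) ℂ => reducedStabilizerPeriod 6 f = 1) →
    (Odd 6 ∨ 1 < Nat.gcd 6 4) →
    IsZariskiGeneric 6 fun f : MvPolynomial (Fin 4) ℂ => ¬ IsIntegrallyClosed (OrbitCoordRing f 6) :=
  fun _ _ _ _ => isZariskiGeneric_not_isIntegrallyClosed_six_four

/-- Cor. 3.17 (2)'s clause at `(D,m) = (5,4)`, PROVED. [cite: BurgisserIkenmeyer2017, Cor. 3.17 (2)] -/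
theorem BI2017_cor_3_17_part2_five_four : 2 ≤ 5 → 2 ≤ 4 →
    IsZariskiGeneric 5 (fun f : MvPolynomial (Fin 4) ℂ => reducedStabilizerPeriod 5 f = 1) →
    (Odd 5 ∨ 1 < Nat.gcd 5 4) →
    IsZariskiGeneric 5 fun f : MvPolynomial (Fin 4) ℂ => ¬ IsIntegrallyClosed (OrbitCoordRing f 5) :=
  fun _ _ _ _ => isZariskiGeneric_not_isIntegrallyClosed_five_four

end Clauses

end Literature.Computability.AlgebraicComplexity
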